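import Summits.HodgeConjecture.HodgeConjecture.Theorems.NikulinTwinTransportTwinSimilitudeAlgebraicMarkings
import Summits.HodgeConjecture.HodgeConjecture.Theorems.NikulinTwinTransportTwinSimilitudeAlgebraicHKMarkedSqLemmas
import Summits.HodgeConjecture.HodgeConjecture.Theorems.NikulinTwinTransportTwinSimilitudeAlgebraicHKLatticeTransport
import Literature.AlgebraicGeometry.Hyperkaehler.K3HilbertType
import Literature.AlgebraicGeometry.HodgeTheory.HodgeTypeConjugation
import Literature.AlgebraicGeometry.HodgeTheory.ChernCharacterBetti
import HarnessLib

/-!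
# Route NikulinTwinTransport · crux X = `TwinSimilitudeAlgebraic` (stmt-HodgeConjecture-13674) —
# line `hyperkaehler-nikulin-anchors`, heart assembly: THE MARKED TRANSPORT MAP `f = φ_Y⁻¹ ∘ g_ℂ ∘ φ_X`

Step "MARKMAN's input" of the heart `HKTwinClassAssembly`
(`Cruxes/TwinSimilitudeAlgebraic/Lines/hyperkaehler_nikulin_anchors.lean`, reshape r2): for two
fourfolds `X, Y` carrying Beauville–Bogomolov markings `MarkedK3Sq[X, φ_X, P_X, z_X]`,
`MarkedK3Sq[Y, φ_Y, P_Y, z_Y]` (the clauses of the Literature facts, verbatim) and a RATIONAL matrix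
`M` with rational two-sided inverse `M′` which is an isometry of the `K3^{[2]}` form `q` on `ℂ²³` and
carries the period to a multiple of the period (`M z_X = c · z_Y`, `c ≠ 0`), the `ℂ`-linear map
`f := φ_Y⁻¹ ∘ M ∘ φ_X : H²(X(ℂ); ℂ) → H²(Y(ℂ); ℂ)` is

* BIJECTIVE (inverse `φ_X⁻¹ ∘ M′ ∘ φ_Y`),
* RATIONAL on rational classes (rational classes are `ℚ²³` in an integral marking,
  `isRationalClass_iff_of_latticeMarking`, and `M` is rational),
* TYPE-PRESERVING (the `(2,0)`-line goes to the `(2,0)`-line because `M z_X ∈ ℂ z_Y`; the `(0,2)`-line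
  by conjugation, markings being real, `conjClass_latticeMarking_symm`, and `M` real; the
  `(1,1)`-classes `= ⟨z, z̄⟩^{⊥_q}` by the isometry; classes of type `(i, j)`, `i + j ≠ 2`, vanish),
* ISOMETRIC IN THE MARKINGS (`q(φ_Y f a, φ_Y f b) = q(φ_X a, φ_X b)`),

which are exactly the hypotheses of `Hyperkaehler.Markman2024_rationalHodgeIsometry_algebraic_marked`.
Pure marking algebra: `exists_markedTransport`.  No definitions, no named facts.  Prover seat
prover-line-stmt-HodgeConjecture-13674-c1-0 (line lead).

## References

* [Markman2024] E. Markman, Compos. Math. 160 (2024), Thm. 1.1 (the consumer).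
* [VoisinHodgeI2002] C. Voisin, Hodge Theory and Complex Algebraic Geometry I, §6.1.3 Cor. 6.12, §7.1.1.
* [Beauville1983] A. Beauville, J. Differential Geom. 18 (1983), §8 Thm. 5 (orthogonality of the
  Hodge decomposition for `q`).
-/

noncomputable section

set_option linter.dupNamespace false

open CategoryTheory
open scoped Matrix
open Literature.AlgebraicGeometry.Motives Literature.AlgebraicGeometry.HodgeTheory
open Literature.AlgebraicGeometry.Surfaces Literature.AlgebraicGeometry.Hyperkaehler
open Literature.AlgebraicTopology.SingularHomology

namespace Summit.HodgeConjecture.HodgeConjecture.Theorems.NikulinTwinTransport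

/-- `MarkedK3Sq[X, φ, P, z]`: the Beauville–Bogomolov marking clauses of a smooth projective
`K3^{[2]}`-type fourfold, VERBATIM those of `Hyperkaehler.CamereEtAl2026_symplecticInvolution_periodSurjective`
/ `Markman2024_rationalHodgeIsometry_algebraic_marked` / `Beauville1983_hilbertSquare_markedIncidence`.
Local notation only. -/
local notation3 (prettyPrint := false) "MarkedK3Sq[" X ", " φ ", " P ", " z "]" =>
  ((IsIntegralClass P ∧ ∀ Q : complexBetti X (2 * 4), IsIntegralClass Q → ∃ n : ℤ, Q = n • P) ∧
    (∀ c : complexBetti X 2, IsIntegralClass c ↔ ∃ v : K3HilbertIndex → ℤ, φ c = fun i => (v i : ℂ)) ∧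
    (∀ a : complexBetti X 2, cupPowTwo a 4 = ((3 : ℂ) * (k3HilbertForm 2 (φ a) (φ a)) ^ 2) • P) ∧
    (IsOfHodgeType 4 X 2 2 0 (LinearEquiv.symm φ z) ∧
      ∀ τ : complexBetti X 2, IsOfHodgeType 4 X 2 2 0 τ → ∃ t : ℂ, τ = t • LinearEquiv.symm φ z) ∧
    (∀ c : complexBetti X 2, IsOfHodgeType 4 X 2 1 1 c ↔
        (k3HilbertForm 2 (φ c) z = 0 ∧ k3HilbertForm 2 (φ c) (star z) = 0)) ∧
    (k3HilbertForm 2 z z = 0 ∧ 0 < (k3HilbertForm 2 (star z) z).re))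

/-- Products of rational matrices cast to `ℂ` entrywise. [folklore] -/
theorem ratCast_map_mul (M N : Matrix K3HilbertIndex K3HilbertIndex ℚ) :
    (M * N).map (fun q : ℚ => (q : ℂ)) = M.map (fun q : ℚ => (q : ℂ)) * N.map (fun q : ℚ => (q : ℂ)) := by
  ext i j
  simp only [Matrix.map_apply, Matrix.mul_apply, Rat.cast_sum, Rat.cast_mul]

/-- The identity matrix casts to the identity matrix. [folklore] -/
theorem ratCast_map_one :
    (1 : Matrix K3HilbertIndex K3HilbertIndex ℚ).map (fun q : ℚ => (q : ℂ)) = 1 := by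
  ext i j
  by_cases h : i = j
  · subst h; simp
  · simp [Matrix.one_apply_ne h]

/-- Two-sided inverse rational matrices stay inverse after casting. [folklore] -/
theorem ratCast_map_mul_eq_one {M M' : Matrix K3HilbertIndex K3HilbertIndex ℚ} (h : M * M' = 1) :
    M.map (fun q : ℚ => (q : ℂ)) * M'.map (fun q : ℚ => (q : ℂ)) = 1 := by
  rw [← ratCast_map_mul, h, ratCast_map_one]

/-- **The marked transport map.**  For BBF-marked fourfolds `(X, φ_X, P_X, z_X)`, `(Y, φ_Y, P_Y, z_Y)`,
a rational matrix `M` with rational two-sided inverse `M′`, `q`-isometric on `ℂ²³`, carrying the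
period `z_X` to `c · z_Y` (`c ≠ 0`), the map `f = φ_Y⁻¹ ∘ M ∘ φ_X` is a bijective, rational,
type-preserving, marked-isometric `ℂ`-linear map `H²(X(ℂ); ℂ) → H²(Y(ℂ); ℂ)` (module docstring).
[cite: Markman2024, Thm. 1.1] [cite: VoisinHodgeI2002, §6.1.3 Cor. 6.12] [cite: Beauville1983, §8 Thm. 5] -/
theorem exists_markedTransport {X Y : SchemeOver ℂ} (hX : IsSmoothProjective 4 X)
    (hY : IsSmoothProjective 4 Y)
    (φX : complexBetti X 2 ≃ₗ[ℂ] (K3HilbertIndex → ℂ)) (PX : complexBetti X (2 * 4))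
    (zX : K3HilbertIndex → ℂ) (φY : complexBetti Y 2 ≃ₗ[ℂ] (K3HilbertIndex → ℂ))
    (PY : complexBetti Y (2 * 4)) (zY : K3HilbertIndex → ℂ)
    (hmX : MarkedK3Sq[X, φX, PX, zX]) (hmY : MarkedK3Sq[Y, φY, PY, zY])
    (M M' : Matrix K3HilbertIndex K3HilbertIndex ℚ) (hMM' : M * M' = 1) (hM'M : M' * M = 1)
    (hiso : ∀ a b : K3HilbertIndex → ℂ,
      k3HilbertForm 2 (M.map (fun q : ℚ => (q : ℂ)) *ᵥ a) (M.map (fun q : ℚ => (q : ℂ)) *ᵥ b) =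
        k3HilbertForm 2 a b)
    {c : ℂ} (hc : c ≠ 0) (hz : M.map (fun q : ℚ => (q : ℂ)) *ᵥ zX = c • zY) :
    ∃ f : complexBetti X 2 →ₗ[ℂ] complexBetti Y 2,
      (∀ a, φY (f a) = M.map (fun q : ℚ => (q : ℂ)) *ᵥ φX a) ∧
      Function.Bijective f ∧
      (∀ x, IsRationalClass x → IsRationalClass (f x)) ∧
      (∀ (i j : ℕ) x, IsOfHodgeType 4 X 2 i j x → IsOfHodgeType 4 Y 2 i j (f x)) ∧
      (∀ a b, k3HilbertForm 2 (φY (f a)) (φY (f b)) = k3HilbertForm 2 (φX a) (φX b)) := by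
  set MC : Matrix K3HilbertIndex K3HilbertIndex ℂ := M.map (fun q : ℚ => (q : ℂ)) with hMC
  set M'C : Matrix K3HilbertIndex K3HilbertIndex ℂ := M'.map (fun q : ℚ => (q : ℂ)) with hM'C
  obtain ⟨-, hintX, -, ⟨-, hlineX⟩, h11X, -⟩ := hmX
  obtain ⟨-, hintY, -, ⟨h20Y, -⟩, h11Y, -⟩ := hmY
  -- the map and its inverse
  let f : complexBetti X 2 →ₗ[ℂ] complexBetti Y 2 :=
    φY.symm.toLinearMap ∘ₗ Matrix.toLin' MC ∘ₗ φX.toLinearMap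
  let f' : complexBetti Y 2 →ₗ[ℂ] complexBetti X 2 :=
    φX.symm.toLinearMap ∘ₗ Matrix.toLin' M'C ∘ₗ φY.toLinearMap
  have hf : ∀ a, f a = φY.symm (MC *ᵥ φX a) := fun a => by
    simp only [f, LinearMap.coe_comp, LinearEquiv.coe_coe, Function.comp_apply, Matrix.toLin'_apply]
  have hf' : ∀ b, f' b = φX.symm (M'C *ᵥ φY b) := fun b => by
    simp only [f', LinearMap.coe_comp, LinearEquiv.coe_coe, Function.comp_apply, Matrix.toLin'_apply]
  have hφf : ∀ a, φY (f a) = MC *ᵥ φX a := fun a => by rw [hf, LinearEquiv.apply_symm_apply]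
  have h1 : M'C * MC = 1 := ratCast_map_mul_eq_one hM'M
  have h2 : MC * M'C = 1 := ratCast_map_mul_eq_one hMM'
  have hleft : Function.LeftInverse f' f := fun a => by
    rw [hf', hφf, Matrix.mulVec_mulVec, h1, Matrix.one_mulVec, LinearEquiv.symm_apply_apply]
  have hright : Function.RightInverse f' f := fun b => by
    rw [hf, hf', LinearEquiv.apply_symm_apply, Matrix.mulVec_mulVec, h2, Matrix.one_mulVec,
      LinearEquiv.symm_apply_apply]
  -- the period line goes to the period line, and so does its conjugate
  have hfz : f (φX.symm zX) = c • φY.symm zY := by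
    rw [hf, LinearEquiv.apply_symm_apply, hz, map_smul]
  have hstarz : MC *ᵥ star zX = (starRingEnd ℂ c) • star zY := by
    rw [← star_ratCast_map_mulVec, ← hMC, hz, star_smul, starRingEnd_apply]
  have hstarc : starRingEnd ℂ c ≠ 0 := (map_ne_zero _).2 hc
  refine ⟨f, hφf, Function.bijective_iff_has_inverse.2 ⟨f', hleft, hright⟩, ?_, ?_, ?_⟩
  · -- rationality
    intro x hx
    obtain ⟨w, hw⟩ := exists_ratCast_of_isRationalClass hX φX hintX hx
    rw [hf, hw, hMC, ratCast_map_mulVec_ratCast]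
    exact isRationalClass_latticeMarking_symm_ratCast φY hintY _
  · -- Hodge types
    intro i j x hx
    obtain ⟨A, -⟩ := id h20Y
    by_cases hij : i + j = 2
    · -- `i ∈ {0, 1, 2}`
      rcases Nat.lt_or_ge i 3 with hi | hi
      · interval_cases i
        · -- `(0, 2)`: conjugate of the `(2, 0)`-line
          obtain rfl : j = 2 := by omega
          have hcx : IsOfHodgeType 4 X 2 2 0 (conjClass (ComplexPoints X) 2 x) := hx.conjClass hX
          obtain ⟨t, ht⟩ := hlineX _ hcx
          have hx' : x = starRingEnd ℂ t • φX.symm (star zX) := by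
            rw [← conjClass_conjClass x, ht, conjClass_smul, conjClass_latticeMarking_symm φX hintX]
          have hfx : f x = (starRingEnd ℂ t * starRingEnd ℂ c) •
              conjClass (ComplexPoints Y) 2 (φY.symm zY) := by
            rw [hx', map_smul, hf, LinearEquiv.apply_symm_apply, hstarz, map_smul, smul_smul,
              conjClass_latticeMarking_symm φY hintY]
          rw [hfx]
          exact (h20Y.conjClass hY).smul _
        · -- `(1, 1)`: the `q`-orthogonal of `z, z̄`
          obtain rfl : j = 1 := by omega
          obtain ⟨hxz, hxzbar⟩ := (h11X x).1 hx
          refine (h11Y (f x)).2 ⟨?_, ?_⟩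
          · have h := hiso (φX x) zX
            rw [hz, k3HilbertForm_smul_right, hxz] at h
            rw [hφf]
            rcases mul_eq_zero.1 h with h0 | h0
            · exact absurd h0 hc
            · exact h0
          · have h := hiso (φX x) (star zX)
            rw [hstarz, k3HilbertForm_smul_right, hxzbar] at h
            rw [hφf]
            rcases mul_eq_zero.1 h with h0 | h0
            · exact absurd h0 hstarc
            · exact h0
        · -- `(2, 0)`: the period line
          obtain rfl : j = 0 := by omega
          obtain ⟨t, rfl⟩ := hlineX x hx
          rw [map_smul, hfz, smul_smul]
          exact h20Y.smul _
      · exfalso; omega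
    · -- `i + j ≠ 2`: the class vanishes
      have hx0 : x = 0 := isOfHodgeType_eq_zero_of_add_ne hx hij
      rw [hx0, map_zero]
      exact IsOfHodgeType.zero A 2 i j
  · -- isometry in the markings
    intro a b
    rw [hφf, hφf, hiso]

/-- Registered anchor of this helper file (closed form of `exists_markedTransport`).
[cite: Markman2024, Thm. 1.1] -/
theorem hkMarkedTransport_anchor : ∀ {X Y : SchemeOver ℂ} (hX : IsSmoothProjective 4 X) (hY : IsSmoothProjective 4 Y) (φX : complexBetti X 2 ≃ₗ[ℂ] (K3HilbertIndex → ℂ)) (PX : complexBetti X (2 * 4)) (zX : K3HilbertIndex → ℂ) (φY : complexBetti Y 2 ≃ₗ[ℂ] (K3HilbertIndex → ℂ)) (PY : complexBetti Y (2 * 4)) (zY : K3HilbertIndex → ℂ), MarkedK3Sq[X, φX, PX, zX] → MarkedK3Sq[Y, φY, PY, zY] → ∀ (M M' : Matrix K3HilbertIndex K3HilbertIndex ℚ), M * M' = 1 → M' * M = 1 → (∀ a b : K3HilbertIndex → ℂ, k3HilbertForm 2 (M.map (fun q : ℚ => (q : ℂ)) *ᵥ a) (M.map (fun q : ℚ =>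 (q : ℂ)) *ᵥ b) = k3HilbertForm 2 a b) → ∀ {c : ℂ}, c ≠ 0 → M.map (fun q : ℚ => (q : ℂ)) *ᵥ zX = c • zY → ∃ f : complexBetti X 2 →ₗ[ℂ] complexBetti Y 2, (∀ a, φY (f a) = M.map (fun q : ℚ => (q : ℂ)) *ᵥ φX a) ∧ Function.Bijective f ∧ (∀ x, IsRationalClass x → IsRationalClass (f x)) ∧ (∀ (i j : ℕ) x, IsOfHodgeType 4 X 2 i j x → IsOfHodgeType 4 Y 2 i j (f x)) ∧ (∀ a b, k3HilbertForm 2 (φY (f a)) (φY (f b)) = k3HilbertForm 2 (φX a) (φX b)) :=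
  fun hX hY φX PX zX φY PY zY hmX hmY M M' hMM' hM'M hiso _ hc hz =>
    exists_markedTransport hX hY φX PX zX φY PY zY hmX hmY M M' hMM' hM'M hiso hc hz

end Summit.HodgeConjecture.HodgeConjecture.Theorems.NikulinTwinTransport

end
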